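import Summits.QuantumFields.YangMills.Theorems.BalabanUVNodesN15TwoGridL2Entries
import Summits.QuantumFields.YangMills.Theorems.BalabanUVNodesN15BackgroundPairSpace
import HarnessLib

/-!
# N15 (NE2) — PROGRAMME K, part K-F: THE STACKED L²-BLOCK CURRENCY — n15-b's stacked jet carrier `X × Option J` read with part 61's L²-block norm (`hasMaj_stack_l2`, `hasMaj_projO_comp_l2`,
# `hasMaj_unstack_l2`, a-priori constants) and Bałaban's (1.114) entry «‖ζGJ‖» (clause 0: `G = Δ_a⁻¹` itself is L²-block → L²-block bounded) — the plumbing for the L²-target edition of III-B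

WHO ∕ WHEN.  Cell `pub-ymgap`, seat `pub-ymgap-dag-n15-a` (KNIT-BY-NAME seat of Track-A DAG node N15 = NE2, g25); `--kind proof --supports stmt-QuantumFields-27366 --as helper` (K3⁸;
count-neutral).  THEOREMS ONLY (0 `def`).  Over part 61 `…TwoGridL2Blocks` (`BlockNorm.l2Blocks`, `sq_loc_l2Blocks`, `loc_l2Blocks_eq`, `HasMaj.to_l2Blocks`), part 62 `…TwoGridL2Entries`
(`loc_le_of_l2loc`, `sq_loc_l2Blocks_eq_nsq`, `sqEta_mul_l2_eq_loc`, `cutInL_blockCut`, `cutSupL_blockCut_le`, `suppInL_vec_of_isLoc`, `inv_mulVec_ofReal_eq`), n15-b B1b `…BackgroundPairSpace`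
(`stack`, `unstack`, `projO`, `blkPair`, `unstack_apply`), n15-b `DerivDefect.exists_const_hasMaj_ofBlocks` BY NAME; nothing in the tree is modified.

WHY (K-E's header).  The cell-oscillation row of `∇′Δ′_a⁻¹` exists for the pair of record in (sup → L²-block) currency (K-E ★★★); g0's jet device `idef_background_propagator_majorant_flat` is
GENERIC in the target block norm `b₂′`.  To run III-B with `b₂′ :=` the L²-block norm on the STACKED fine carrier one needs the stacked-carrier calculus of n15-b B1b (`hasMaj_stack`,
`hasMaj_projO_comp`, `hasMaj_unstack`) in L²-block currency, an a-priori constant, and the fine-side `U ≡ 1` rows `G′`, `∇′G′` as L²-block → L²-block operators — the latter are Bałaban's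
PRINTED (1.114) entries «‖ζGJ‖» (clause 0, typed here) and «‖ζ∇GJ‖» (clause 1, part 62).

WHAT.  §9 (generic [B6] carrier `g`, blocks `blk`, weight `w`): `sq_loc_l2Blocks_blkPair` (`loc(y, F)² = Σ_j loc(y, F(·, j))²` on the stacked carrier), ★ `hasMaj_stack_l2` (common majorant `K` of the
pieces ⟹ `(1 + |J|)·K` for the stack), ★ `hasMaj_projO_comp_l2` (components inherit), ★ `hasMaj_unstack_l2` (`diagK (r(1 + |J|))` from the sup letters `|c|, |a_μ| ≤ r`, pointwise
Cauchy–Schwarz), `exists_const_hasMaj_l2` (a-priori (sup → L²) constant).  §10 ★ `hasMajL2_gOp_of_ineq` ((1.114) clause 0 in L²-block currency, generic `n`), ★ `hasMajL2_gOp_pair` (both members of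
the η-pair of record, ONE constant, through `ineq110_114_pair`).

HONEST FRAMING ∕ LIMITS.  Finite-dimensional bookkeeping ([folklore]) + (1.114) clause 0 BY NAME at `U ≡ 1` on the torus family of record; no estimate of [B5]∕[B9] beyond the cited printed
inequality; NE2⁺ NOT printed ∕ NOT proved; no statement of record touched; N15 NOT discharged; K3⁸ OPEN; counts UNMOVED (typed 28∕28 · discharged 5∕27); one finite torus per index — NOT ℝ⁴ ∕
infinite volume ∕ OS ∕ mass gap ∕ Clay.
-/

noncomputable section

open scoped BigOperators
open Finset

namespace Summit.QuantumFields.YangMills.BalabanUVNodes.N15.TwoGrid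

open Literature.MathematicalPhysics.QuantumFieldTheory.Balaban1983to89
open Literature.MathematicalPhysics.QuantumFieldTheory.Balaban1983to89.B11SectG (BlockNorm HasMaj)
open Literature.MathematicalPhysics.QuantumFieldTheory.Balaban1983to89.T4EtaRateCoeffDefect (pull pull_apply diagK diagK_same diagK_ne)
open Literature.MathematicalPhysics.QuantumFieldTheory.Balaban1983to89.B6Prop26Gluing (mulOp mulOp_apply)
open Literature.MathematicalPhysics.QuantumFieldTheory.Balaban1983to89.B5Prop11Plancherel (Tor fine unitVec)
open Literature.MathematicalPhysics.QuantumFieldTheory.Balaban1983to89.B5DeltaA169 (DeltaA)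
open Literature.MathematicalPhysics.QuantumFieldTheory.Balaban1983to89.B5Prop11Lower (nsq nsq_nonneg)
open Literature.MathematicalPhysics.QuantumFieldTheory.Balaban1983to89.B5Prop11Lattice (l2)
open Literature.MathematicalPhysics.QuantumFieldTheory.Balaban1983to89.B5Prop12FieldsLattice (suppInL smulV cutInL cutSupL)
open Literature.MathematicalPhysics.QuantumFieldTheory.Balaban1983to89.B5SettingP12Real (LocR latticeSettingP12R)
open Literature.MathematicalPhysics.QuantumFieldTheory.Balaban1983to89.B5SiteBridgeP12 (MP)
open Literature.MathematicalPhysics.QuantumFieldTheory.Balaban1983to89.B5SettingP12Weighted (etaPow etaPow_nonneg sqEta sqEta_nonneg sqEta_sq)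
open Literature.MathematicalPhysics.QuantumFieldTheory.King1986.Torus (blockOf tdistT tdistT_nonneg)
open Literature.MathematicalPhysics.QuantumFieldTheory.Balaban1983to89.B6UnitTorusCarrier (unitTorusGeo)
open Summit.QuantumFields.YangMills.BalabanUVNodes.N15.BackgroundLayer (stack unstack projO blkPair stack_apply_none stack_apply_some projO_apply unstack_apply)
open Summit.QuantumFields.YangMills.BalabanUVNodes.N15.DerivDefect (exists_const_hasMaj_ofBlocks)

variable {d : ℕ}

/-! ## §9 The stacked carrier in L²-block currency -/

section StackL2

variable {X J : Type} [Fintype X] [Fintype J] {F₁ : Type} [AddCommGroup F₁] [Module ℝ F₁] {g : B6.Geometry} [DecidableEq g.Site] {blk : X → g.Site} {w : ℝ}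

/-- THE STACKED L²-BLOCK SIZE IS THE ℓ² SUM OF THE COMPONENTS' SIZES: `loc(y, F)² = Σ_{j : Option J} loc(y, F(·, j))²` (blocks `blkPair blk`, same weight). [folklore] -/
theorem sq_loc_l2Blocks_blkPair (hw : 0 ≤ w) (y : g.Site) (F : X × Option J → ℝ) :
    (BlockNorm.l2Blocks g (blkPair (J := J) blk) w hw).loc y F ^ 2 = ∑ j : Option J, (BlockNorm.l2Blocks g blk w hw).loc y (fun x => F (x, j)) ^ 2 := by
  classical
  rw [sq_loc_l2Blocks hw, Finset.sum_filter, Fintype.sum_prod_type, Finset.sum_comm, Finset.mul_sum]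
  refine Finset.sum_congr rfl fun j _ => ?_
  rw [sq_loc_l2Blocks hw, Finset.sum_filter]

/-- ★ **A COMMON MAJORANT OF THE PIECES MAJORISES THE STACK, L²-BLOCK EDITION** (`K ≥ 0`): `(1 + |J|)·K`. [folklore] -/
theorem hasMaj_stack_l2 (hw : 0 ≤ w) {b₁ : BlockNorm g F₁} {G : F₁ →ₗ[ℝ] (X → ℝ)} {D : J → F₁ →ₗ[ℝ] (X → ℝ)} {K : g.Site → g.Site → ℝ}
    (hK : ∀ y y', 0 ≤ K y y') (hG : HasMaj b₁ (BlockNorm.l2Blocks g blk w hw) G K) (hD : ∀ μ, HasMaj b₁ (BlockNorm.l2Blocks g blk w hw) (D μ) K) :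
    HasMaj b₁ (BlockNorm.l2Blocks g (blkPair (J := J) blk) w hw) (stack G D) (fun y y' => (1 + Fintype.card J) * K y y') := by
  intro y' v hv y
  set ℓ := b₁.loc y' v with hℓ
  have hℓ0 : 0 ≤ ℓ := b₁.loc_nonneg y' v
  have hKℓ : 0 ≤ K y y' * ℓ := mul_nonneg (hK y y') hℓ0
  have hcomp : ∀ j : Option J, (BlockNorm.l2Blocks g blk w hw).loc y (fun x => stack G D v (x, j)) ≤ K y y' * ℓ := by
    rintro (_ | μ)
    · exact hG y' v hv y
    · exact hD μ y' v hv y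
  have hsq : (BlockNorm.l2Blocks g (blkPair (J := J) blk) w hw).loc y (stack G D v) ^ 2 ≤ ((1 + Fintype.card J) * K y y' * ℓ) ^ 2 := by
    rw [sq_loc_l2Blocks_blkPair hw]
    calc ∑ j : Option J, (BlockNorm.l2Blocks g blk w hw).loc y (fun x => stack G D v (x, j)) ^ 2
        ≤ ∑ _j : Option J, (K y y' * ℓ) ^ 2 := Finset.sum_le_sum fun j _ =>
          pow_le_pow_left₀ ((BlockNorm.l2Blocks g blk w hw).loc_nonneg _ _) (hcomp j) 2
      _ = (1 + Fintype.card J) * (K y y' * ℓ) ^ 2 := by rw [Finset.sum_const, Finset.card_univ, nsmul_eq_mul, Fintype.card_option]; push_cast; ring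
      _ ≤ ((1 + Fintype.card J) * K y y' * ℓ) ^ 2 := by
          have hJ : (1 : ℝ) ≤ 1 + Fintype.card J := le_add_of_nonneg_right (Nat.cast_nonneg _)
          nlinarith [sq_nonneg (K y y' * ℓ), mul_nonneg (sub_nonneg.mpr hJ) (sq_nonneg (K y y' * ℓ))]
  have h0 : 0 ≤ (1 + Fintype.card J) * K y y' * ℓ := mul_nonneg (mul_nonneg (by positivity) (hK y y')) hℓ0
  exact (pow_le_pow_iff_left₀ ((BlockNorm.l2Blocks g (blkPair (J := J) blk) w hw).loc_nonneg _ _) h0 two_ne_zero).mp hsq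

omit [Fintype J] in
/-- ★ **COMPONENTS INHERIT THE STACK'S L²-BLOCK MAJORANT.** [folklore] -/
theorem hasMaj_projO_comp_l2 [Fintype J] (hw : 0 ≤ w) {b₁ : BlockNorm g F₁} {T : F₁ →ₗ[ℝ] (X × Option J → ℝ)} {K : g.Site → g.Site → ℝ}
    (h : HasMaj b₁ (BlockNorm.l2Blocks g (blkPair (J := J) blk) w hw) T K) (j : Option J) :
    HasMaj b₁ (BlockNorm.l2Blocks g blk w hw) (projO j ∘ₗ T) K := by
  intro y' v hv y
  have hst := h y' v hv y
  have hle : (BlockNorm.l2Blocks g blk w hw).loc y ((projO j ∘ₗ T) v) ^ 2 ≤ (BlockNorm.l2Blocks g (blkPair (J := J) blk) w hw).loc y (T v) ^ 2 := by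
    rw [sq_loc_l2Blocks_blkPair hw]
    exact Finset.single_le_sum (f := fun j' : Option J => (BlockNorm.l2Blocks g blk w hw).loc y (fun x => T v (x, j')) ^ 2) (fun _ _ => sq_nonneg _) (Finset.mem_univ j)
  have h0 := (BlockNorm.l2Blocks g (blkPair (J := J) blk) w hw).loc_nonneg y (T v)
  exact ((pow_le_pow_iff_left₀ ((BlockNorm.l2Blocks g blk w hw).loc_nonneg _ _) h0 two_ne_zero).mp hle).trans hst

/-- ★ **THE UNSTACKED PERTURBATION IN L²-BLOCK CURRENCY**: `|c|, |a_μ| ≤ r` ⟹ `unstack c a ≤ diagK (r(1 + |J|))` from the stacked L²-blocks to the L²-blocks (pointwise Cauchy–Schwarz over the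
`1 + |J|` components; `√(1+|J|) ≤ 1 + |J|`). [cite: Balaban1985BackgroundPropagators, (3.35) p.396 («|A| < O(1)Mα₀(L^jη)^{−1}»: shape)] -/
theorem hasMaj_unstack_l2 (hw : 0 ≤ w) {c : X → ℝ} {a : J → X → ℝ} {r : ℝ} (hr : 0 ≤ r) (hc : ∀ x, |c x| ≤ r) (ha : ∀ μ x, |a μ x| ≤ r) :
    HasMaj (BlockNorm.l2Blocks g (blkPair (J := J) blk) w hw) (BlockNorm.l2Blocks g blk w hw) (unstack c a) (diagK fun _ => r * (1 + Fintype.card J)) := by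
  classical
  intro y' f hf y
  have hf' : ∀ p : X × Option J, blk p.1 ≠ y' → f p = 0 := hf
  set Lst := (BlockNorm.l2Blocks g (blkPair (J := J) blk) w hw).loc y' f with hLst
  have hLst0 : 0 ≤ Lst := (BlockNorm.l2Blocks g (blkPair (J := J) blk) w hw).loc_nonneg y' f
  by_cases hy : y = y'
  · subst hy
    rw [diagK_same]
    -- pointwise Cauchy–Schwarz: `(unstack f x)² ≤ r²(1+|J|)·Σ_j f(x,j)²`
    have hpt : ∀ x, (unstack c a f x) ^ 2 ≤ r ^ 2 * (1 + Fintype.card J) * ∑ j : Option J, f (x, j) ^ 2 := by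
      intro x
      have h1 : |unstack c a f x| ≤ ∑ j : Option J, r * |f (x, j)| := by
        rw [unstack_apply, Fintype.sum_option]
        refine (abs_add_le _ _).trans (add_le_add ?_ ((Finset.abs_sum_le_sum_abs _ _).trans (Finset.sum_le_sum fun μ _ => ?_)))
        · rw [abs_mul]; exact mul_le_mul_of_nonneg_right (hc x) (abs_nonneg _)
        · rw [abs_mul]; exact mul_le_mul_of_nonneg_right (ha μ x) (abs_nonneg _)
      have hCS := Finset.sum_mul_sq_le_sq_mul_sq (Finset.univ : Finset (Option J)) (fun _ => r) (fun j => |f (x, j)|)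
      have h2 : (∑ j : Option J, r * |f (x, j)|) ^ 2 ≤ r ^ 2 * (1 + Fintype.card J) * ∑ j : Option J, f (x, j) ^ 2 := by
        refine hCS.trans (le_of_eq ?_)
        rw [Finset.sum_const, Finset.card_univ, Fintype.card_option]
        simp only [sq_abs]
        ring
      have h3 : (unstack c a f x) ^ 2 ≤ (∑ j : Option J, r * |f (x, j)|) ^ 2 := by
        rw [← sq_abs (unstack c a f x)]
        exact pow_le_pow_left₀ (abs_nonneg _) h1 2
      exact h3.trans h2
    have hsq : (BlockNorm.l2Blocks g blk w hw).loc y (unstack c a f) ^ 2 ≤ (r * (1 + Fintype.card J) * Lst) ^ 2 := by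
      rw [sq_loc_l2Blocks hw]
      have hJ : (1 : ℝ) ≤ 1 + Fintype.card J := le_add_of_nonneg_right (Nat.cast_nonneg _)
      calc w * ∑ x ∈ univ.filter (fun x => blk x = y), unstack c a f x ^ 2
          ≤ w * ∑ x ∈ univ.filter (fun x => blk x = y), r ^ 2 * (1 + Fintype.card J) * ∑ j : Option J, f (x, j) ^ 2 :=
            mul_le_mul_of_nonneg_left (Finset.sum_le_sum fun x _ => hpt x) hw
        _ = r ^ 2 * (1 + Fintype.card J) * (w * ∑ x ∈ univ.filter (fun x => blk x = y), ∑ j : Option J, f (x, j) ^ 2) := by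
            rw [← Finset.mul_sum]; ring
        _ = r ^ 2 * (1 + Fintype.card J) * Lst ^ 2 := by
            rw [hLst, sq_loc_l2Blocks_blkPair hw]
            simp only [sq_loc_l2Blocks hw]
            rw [← Finset.mul_sum, Finset.sum_comm]
        _ ≤ (r * (1 + Fintype.card J) * Lst) ^ 2 := by
            nlinarith [mul_nonneg (mul_nonneg (sq_nonneg r) (sub_nonneg.mpr hJ)) (sq_nonneg Lst), mul_nonneg (sq_nonneg r) (sq_nonneg Lst),
              mul_nonneg (mul_nonneg (mul_nonneg (sq_nonneg r) (sub_nonneg.mpr hJ)) (Nat.cast_nonneg (Fintype.card J))) (sq_nonneg Lst)]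
    exact (pow_le_pow_iff_left₀ ((BlockNorm.l2Blocks g blk w hw).loc_nonneg _ _) (by positivity) two_ne_zero).mp hsq
  · rw [diagK_ne _ hy, zero_mul]
    refine le_of_eq ?_
    rw [loc_l2Blocks_eq hw]
    have h0 : ∑ x ∈ univ.filter (fun x => blk x = y), unstack c a f x ^ 2 = 0 := by
      refine Finset.sum_eq_zero fun x hx => ?_
      rw [mem_filter] at hx
      have hz : ∀ j : Option J, f (x, j) = 0 := fun j => hf' (x, j) (by rw [hx.2]; exact hy)
      simp [unstack_apply, hz]
    rw [h0, mul_zero, Real.sqrt_zero]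

/-- AN A-PRIORI (sup → L²-BLOCK) CONSTANT: every linear map between finite lattices has SOME constant block majorant into the L²-blocks (n15-b's `exists_const_hasMaj_ofBlocks` + part 61's
comparison). [folklore] -/
theorem exists_const_hasMaj_l2 {X₁ : Type} [Fintype X₁] [DecidableEq X₁] (hw : 0 ≤ w) (blk₁ : X₁ → g.Site) (T : (X₁ → ℝ) →ₗ[ℝ] (X → ℝ)) :
    ∃ M₁ : ℝ, 0 ≤ M₁ ∧ HasMaj (BlockNorm.ofBlocks g blk₁) (BlockNorm.l2Blocks g blk w hw) T (fun _ _ => M₁) := by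
  classical
  obtain ⟨M₀, hM₀, h⟩ := exists_const_hasMaj_ofBlocks (g := g) blk₁ blk T
  refine ⟨Real.sqrt (w * Fintype.card X) * M₀, by positivity, ?_⟩
  exact HasMaj.to_l2Blocks (g := g) (blk := blk) (w := w) hw (fun y => mul_le_mul_of_nonneg_left (by exact_mod_cast Finset.card_le_univ _) hw) h

end StackL2

/-! ## §10 Bałaban's (1.114), clause 0: `Δ_a⁻¹` is L²-block → L²-block bounded -/

section Clause0

open Matrix

variable {L : ℕ} (M : Fin (d + 1) → ℕ) [∀ μ, NeZero (M μ)] (k : ℕ) (n : ℕ) [NeZero n] (a : ℝ)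

/-- ★ **(1.114) ENTRY «ζGJ» IN L²-BLOCK CURRENCY (generic `n`)**: `HasMaj (l2Blocks η^D) (l2Blocks η^D) (Δ_a⁻¹) (C·e^{−δ₀|y−y′|_T})`. [cite: Balaban1984PropagatorsI, Prop. 1.2 (1.114) p.36 (‖ζGJ‖)] -/
theorem hasMajL2_gOp_of_ineq (hn : 1 ≤ n) {K : ℕ} {C δ₀ : ℝ} {Cα Cε : ℝ → ℝ} {Cαε : ℝ → ℝ → ℝ}
    (H : B5.Ineq110_114 (latticeSettingP12R n M a K) C Cα Cε Cαε δ₀) (hC : 0 ≤ C) :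
    HasMaj (BlockNorm.l2Blocks (unitTorusGeo L k M) (fun i : Tor (fine n M) × Fin (d + 1) => blockOf n M i.1) (etaPow n (d + 1)) (etaPow_nonneg _ _))
      (BlockNorm.l2Blocks (unitTorusGeo L k M) (fun i : Tor (fine n M) × Fin (d + 1) => blockOf n M i.1) (etaPow n (d + 1)) (etaPow_nonneg _ _))
      (gOp M n a) (fun y y' => C * Real.exp (-(δ₀ * tdistT M y y'))) := by
  classical
  intro y' f hf y
  set b := BlockNorm.l2Blocks (unitTorusGeo L k M) (fun i : Tor (fine n M) × Fin (d + 1) => blockOf n M i.1) (etaPow n (d + 1)) (etaPow_nonneg _ _) with hb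
  have hsupp : suppInL n M (LocR.vec f).emb y' := suppInL_vec_of_isLoc M k n hn hf
  have h114 := H.2.2.2.2 0 (LocR.vec f) (blockCut M n y) y y' (cutInL_blockCut M n hn y) hsupp
  have hG : ((DeltaA n M a)⁻¹ *ᵥ fun i => ((f i : ℝ) : ℂ)) = fun i => ((gOp M n a f i : ℝ) : ℂ) := inv_mulVec_ofReal_eq M n a f
  have hsq : b.loc y (gOp M n a f) ^ 2 ≤ (sqEta n (d + 1) * l2 (smulV n M (blockCut M n y) ((DeltaA n M a)⁻¹ *ᵥ fun i => ((f i : ℝ) : ℂ)))) ^ 2 := by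
    rw [hb, sq_loc_l2Blocks_eq_nsq M k n _ _ y, mul_pow, sqEta_sq, hG, l2, Real.sq_sqrt (nsq_nonneg _)]
    rfl
  refine loc_le_of_l2loc M k n hC (mul_nonneg (sqEta_nonneg _ _) (by unfold l2; exact Real.sqrt_nonneg _))
    (cutSupL_blockCut_le M n y) (sqEta_mul_l2_eq_loc M k n hf) hsq ?_
  have e : (latticeSettingP12R n M a K).l2loc 0 (LocR.vec f) (blockCut M n y)
      = sqEta n (d + 1) * l2 (smulV n M (blockCut M n y) ((DeltaA n M a)⁻¹ *ᵥ fun i => ((f i : ℝ) : ℂ))) := rfl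
  rw [← e, ← distSite_eq_tdistT]
  exact h114

end Clause0

section Clause0Pair

variable (d) {L : ℕ} [NeZero L]

/-- ★ **CLAUSES 0 AND 1 OF (1.114) FOR BOTH MEMBERS OF THE η-PAIR OF RECORD, ONE CONSTANT**: `G`, `∇_μG` as L²-block → L²-block operators on `n ∈ {L^k, L^mL^k}` (torus `M_μ = 2L^{m_T}`).
[cite: Balaban1984PropagatorsI, Prop. 1.2 (1.114) p.36 (‖ζGJ‖, ‖ζ∇GJ‖)] -/
theorem hasMajL2_gOp_pair (hL : Odd L ∧ 1 < L) {a : ℝ} (ha : 0 < a) :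
    ∃ δ₀ C : ℝ, 0 < δ₀ ∧ 0 < C ∧ ∀ (mT k m : ℕ) (hk : 1 ≤ k),
      ∀ n ∈ ({L ^ k, L ^ m * L ^ k} : Finset ℕ), ∀ hn : NeZero n,
        HasMaj (BlockNorm.l2Blocks (unitTorusGeo L k (MP (paramsOf d L mT k hL))) (fun i : Tor (fine n (MP (paramsOf d L mT k hL))) × Fin (d + 1) => blockOf n (MP (paramsOf d L mT k hL)) i.1)
            (etaPow n (d + 1)) (etaPow_nonneg _ _))
          (BlockNorm.l2Blocks (unitTorusGeo L k (MP (paramsOf d L mT k hL))) (fun i : Tor (fine n (MP (paramsOf d L mT k hL))) × Fin (d + 1) => blockOf n (MP (paramsOf d L mT k hL)) i.1)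
            (etaPow n (d + 1)) (etaPow_nonneg _ _))
          (gOp (MP (paramsOf d L mT k hL)) n a) (fun y y' => C * Real.exp (-(δ₀ * tdistT (MP (paramsOf d L mT k hL)) y y'))) ∧
        ∀ μ : Fin (d + 1), HasMaj (BlockNorm.l2Blocks (unitTorusGeo L k (MP (paramsOf d L mT k hL))) (fun i : Tor (fine n (MP (paramsOf d L mT k hL))) × Fin (d + 1) => blockOf n (MP (paramsOf d L mT k hL)) i.1)
            (etaPow n (d + 1)) (etaPow_nonneg _ _))
          (BlockNorm.l2Blocks (unitTorusGeo L k (MP (paramsOf d L mT k hL))) (fun i : Tor (fine n (MP (paramsOf d L mT k hL))) × Fin (d + 1) => blockOf n (MP (paramsOf d L mT k hL)) i.1)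
            (etaPow n (d + 1)) (etaPow_nonneg _ _))
          (symbOp (MP (paramsOf d L mT k hL)) n (sD (MP (paramsOf d L mT k hL)) n μ n) ∘ₗ gOp (MP (paramsOf d L mT k hL)) n a)
          (fun y y' => C * Real.exp (-(δ₀ * tdistT (MP (paramsOf d L mT k hL)) y y'))) := by
  obtain ⟨δ₀, C, Cα, Cε, Cαε, hδ₀, hC, HP⟩ := ineq110_114_pair (d := d) hL ha
  refine ⟨δ₀, C, hδ₀, hC, fun mT k m hk n hn hne => ?_⟩
  have hL0 : 0 < L := Nat.pos_of_ne_zero (NeZero.ne L)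
  rw [Finset.mem_insert, Finset.mem_singleton] at hn
  rcases hn with rfl | rfl
  · have hn1 : 1 ≤ L ^ k := Nat.one_le_pow _ _ hL0
    exact ⟨hasMajL2_gOp_of_ineq _ k _ a hn1 (HP mT k m hk).1 hC.le, fun μ => hasMajL2_grad_of_ineq _ k _ a hn1 (HP mT k m hk).1 hC.le μ⟩
  · have hn1 : 1 ≤ L ^ m * L ^ k := Nat.one_le_iff_ne_zero.mpr (Nat.mul_ne_zero (pow_ne_zero m (NeZero.ne L)) (pow_ne_zero k (NeZero.ne L)))
    exact ⟨hasMajL2_gOp_of_ineq _ k _ a hn1 (HP mT k m hk).2 hC.le, fun μ => hasMajL2_grad_of_ineq _ k _ a hn1 (HP mT k m hk).2 hC.le μ⟩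

end Clause0Pair

end Summit.QuantumFields.YangMills.BalabanUVNodes.N15.TwoGrid

end
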